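import Mathlib
import Summits.RiemannHypothesis.RiemannHypothesis.Theorems.WeilGroundStateGroundStatesConvergeToXiTightGeoEnergy
import Summits.RiemannHypothesis.RiemannHypothesis.Theorems.WeilGroundStateGroundStatesConvergeToXiEnergySubexp
import Summits.RiemannHypothesis.RiemannHypothesis.Theorems.WeilGroundStateGroundStatesConvergeToXiLineExactWeak
import Summits.RiemannHypothesis.RiemannHypothesis.Theorems.WeilGroundStateGroundStatesConvergeToXiLineExact
import Literature.NumberTheory.LFunctions.WeilGroundState
import HarnessLib

/-!
# C⁺ along windows of at most geometric growth implies RH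
(crux item stmt-RiemannHypothesis-1527 `GroundStatesConvergeToXi`, route
route-RiemannHypothesis-WeilGroundState, line `Sketch`; `--supports`)

The line's load-bearing stub C⁺ (`stub_tightWeakLimit`) asks, along SOME windows `a_k → ∞`,
for renormalised ground states `c_k u_k` tight in every `L¹(e^{b|t|})`, `b < 1/2`, converging
weakly to Riemann's kernel `Φ`.  `…RHofHalfTight.lean` shows that tightness AT `b = 1/2`
already gives RH.  `…TightGeoEnergy.lean` shows that a C⁺-witness whose windows grow at most
geometrically (`a_{k+1} ≤ A a_k`) makes the ground energy sub-exponential, and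
`…EnergySubexp.lean` that a sub-exponential ground energy means RH.  Hence:

* `riemannHypothesis_of_tightWeakLimit_geometric` — **C⁺ with witness windows of at most
  geometric growth ⇒ RH**;
* `riemannHypothesis_of_tight_cruxWitness_geometric` — the same for a witness of the crux tight
  for every `b < 1/2` (the weak limit `Φ` comes from the critical line,
  `tendsto_integral_mul_of_tendsto_criticalLine`);
* `riemannHypothesis_of_nonneg_cruxWitness_geometric`,
  `riemannHypothesis_of_groundStatesConvergeToXi_nonneg_geometric`,
  `riemannHypothesis_of_nonneg_cruxWitness_nat` — **a witness of the crux with a.e. non-negative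
  renormalised ground states (the Perron–Frobenius shape) along geometric, e.g. consecutive,
  windows proves RH by itself**: no `GroundStateSimpleEven`, no Connes–van Suijlekom, no Hurwitz
  (tightness is automatic for such witnesses, `tight_of_nonneg`).

Passing to a subsequence of a witness is free, so "at most geometric growth" is the only
residual condition: a witness along `a_k = k + 1`, `2^k`, or any sequence meeting every
`[x, A x]`, `x` large, is RH-complete.  (For arbitrarily sparse windows the argument controls
`ε` only near the `a_k`; under ¬RH the ground energy is merely known to sink exponentially
along SOME sequence — `riemannHypothesis_iff_weilGroundEnergy_subexp`.)
-/

noncomputable section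

set_option linter.dupNamespace false

open scoped Topology Real ComplexConjugate
open Filter Set MeasureTheory Complex

namespace Summit.RiemannHypothesis.RiemannHypothesis.Theorems.GroundStatesConvergeToXi

open Literature.NumberTheory.LFunctions

/-! ## C⁺ along geometric windows ⇒ RH -/

/-- **Tight renormalised ground states with a non-degenerate pairing along geometric windows ⇒
RH.**  Ground states `u_k` at windows `0 < a_k → ∞` with `a_{k+1} ≤ A a_k`, scalars `c_k` tight
in every `L¹(e^{b|t|})`, `b < 1/2`, and one test function `h₀` supported in all windows with
`‖⟨c_k u_k, h₀⟩‖ ≥ η > 0`, imply RH: `ε` is sub-exponential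
(`neg_exp_le_weilGroundEnergy_of_tight`, `…_of_geometric`), and
`riemannHypothesis_of_weilGroundEnergy_subexp` applies. -/
theorem riemannHypothesis_of_nondegenerate_tight_geometric {a : ℕ → ℝ} {u : ℕ → ℝ → ℂ}
    {c : ℕ → ℂ} (ha : Tendsto a atTop atTop) {A : ℝ} (hA : ∀ k, a (k + 1) ≤ A * a k)
    (hu : ∀ k, IsWeilGroundState (a k) (u k))
    (htight : ∀ b : ℝ, b < 1 / 2 → ∃ M : ℝ, ∀ k, ∫ t, ‖c k * u k t‖ * Real.exp (b * |t|) ≤ M)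
    {h₀ : ℝ → ℂ} (hh₀ : IsWeilTest h₀) (hsupp : ∀ k, tsupport h₀ ⊆ Icc (-(a k)) (a k))
    {η : ℝ} (hη : 0 < η) (hηk : ∀ k, η ≤ ‖∫ t, c k * u k t * conj (h₀ t)‖) :
    RiemannHypothesis := by
  refine riemannHypothesis_of_weilGroundEnergy_subexp fun δ hδ => ?_
  have hA1 : 0 < max A 1 := lt_of_lt_of_le zero_lt_one (le_max_right _ _)
  set δ' : ℝ := δ / max A 1 with hδ'
  have hδ'0 : 0 < δ' := div_pos hδ hA1
  obtain ⟨K, hK0, hK⟩ :=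
    neg_exp_le_weilGroundEnergy_of_tight hu htight hh₀ hsupp hη hηk hδ'0
  refine ⟨K * Real.exp (δ' * a 0), fun x hx => ?_⟩
  have h := neg_exp_le_weilGroundEnergy_of_geometric ha (fun k => (hu k).pos) hA hK0 hδ'0.le hK hx
  have e : max A 1 * δ' * x = δ * x := by
    rw [hδ']
    field_simp
  rwa [e] at h

/-- **C⁺ along geometric windows ⇒ RH.**  If the line's stub `stub_tightWeakLimit` has a witness
whose windows grow at most geometrically (`a_{k+1} ≤ A a_k`) — ground states `u_k`, scalars
`c_k`, tightness in every `L¹(e^{b|t|})`, `b < 1/2`, weak convergence to `Φ = 2Ψ(2·)` — then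
RH (`neg_exp_le_weilGroundEnergy_of_tightWeakLimit_geometric` +
`riemannHypothesis_of_weilGroundEnergy_subexp`). -/
theorem riemannHypothesis_of_tightWeakLimit_geometric
    (h : ∃ a : ℕ → ℝ, ∃ u : ℕ → ℝ → ℂ, ∃ c : ℕ → ℂ, Tendsto a atTop atTop ∧
      (∃ A : ℝ, ∀ k, a (k + 1) ≤ A * a k) ∧
      (∀ k, IsWeilGroundState (a k) (u k)) ∧
      (∀ b : ℝ, b < 1 / 2 → ∃ M : ℝ, ∀ k, ∫ t, ‖c k * u k t‖ * Real.exp (b * |t|) ≤ M) ∧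
      (∀ g : ℝ → ℂ, IsWeilTest g →
        Tendsto (fun k => ∫ t, c k * u k t * g t) atTop
          (𝓝 (∫ t, 2 * LagariasMontague.Psic (2 * t) * g t)))) :
    RiemannHypothesis := by
  obtain ⟨a, u, c, ha, ⟨A, hA⟩, hu, htight, hweak⟩ := h
  exact riemannHypothesis_of_weilGroundEnergy_subexp fun δ hδ =>
    neg_exp_le_weilGroundEnergy_of_tightWeakLimit_geometric ha hA hu htight hweak hδ

/-- **A witness of the crux, tight below the polar exponent, along geometric windows ⇒ RH.**
Ground states `u_k` along `0 < a_k → ∞` with `a_{k+1} ≤ A a_k`, scalars `c_k` with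
`c_k · weilMellin u_k → ξ` locally uniformly on the open strip (the crux's convergence clause;
`c_k ≠ 0` is not needed) and tightness in every `L¹(e^{b|t|})`, `b < 1/2`, imply RH (the weak
limit `Φ` comes from `tendsto_integral_mul_of_tendsto_criticalLine`). -/
theorem riemannHypothesis_of_tight_cruxWitness_geometric
    (h : ∃ a : ℕ → ℝ, ∃ u : ℕ → ℝ → ℂ, ∃ c : ℕ → ℂ, Tendsto a atTop atTop ∧
      (∃ A : ℝ, ∀ k, a (k + 1) ≤ A * a k) ∧
      (∀ k, IsWeilGroundState (a k) (u k)) ∧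
      (∀ b : ℝ, b < 1 / 2 → ∃ M : ℝ, ∀ k, ∫ t, ‖c k * u k t‖ * Real.exp (b * |t|) ≤ M) ∧
      TendstoLocallyUniformlyOn (fun k s => c k * weilMellin (u k) s) riemannXi atTop
        {s : ℂ | 0 < s.re ∧ s.re < 1}) :
    RiemannHypothesis := by
  obtain ⟨a, u, c, ha, hA, hu, htight, hlim⟩ := h
  obtain ⟨M, hM⟩ := htight 0 (by norm_num)
  exact riemannHypothesis_of_tightWeakLimit_geometric ⟨a, u, c, ha, hA, hu, htight, fun g hg =>
    tendsto_integral_mul_of_tendsto_criticalLine (fun k => (hu k).integrable)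
      ⟨M, integral_norm_le_of_tight hu le_rfl hM⟩
      (fun τ => hlim.tendsto_at (criticalLine_mem_strip τ)) hg⟩

/-- **A Perron–Frobenius-shaped witness of the crux along geometric windows proves RH.**  If
the crux `GroundStatesConvergeToXi` has a witness `(a_k, u_k, c_k)` with windows of at most
geometric growth and renormalised ground states `c_k u_k` a.e. real and NON-NEGATIVE, then RH
holds — tightness for every `b < 1/2` is automatic for such witnesses (`tight_of_nonneg`).  So
for positive ground states the crux alone (without `GroundStateSimpleEven`, Connes–van Suijlekom
or Hurwitz) is RH-complete along geometric windows. -/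
theorem riemannHypothesis_of_nonneg_cruxWitness_geometric
    (h : ∃ a : ℕ → ℝ, ∃ u : ℕ → ℝ → ℂ, ∃ c : ℕ → ℂ, Tendsto a atTop atTop ∧
      (∃ A : ℝ, ∀ k, a (k + 1) ≤ A * a k) ∧
      (∀ k, IsWeilGroundState (a k) (u k)) ∧
      (∀ k, ∀ᵐ t : ℝ, 0 ≤ (c k * u k t).re ∧ (c k * u k t).im = 0) ∧
      TendstoLocallyUniformlyOn (fun k s => c k * weilMellin (u k) s) riemannXi atTop
        {s : ℂ | 0 < s.re ∧ s.re < 1}) :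
    RiemannHypothesis := by
  obtain ⟨a, u, c, ha, hA, hu, hnn, hlim⟩ := h
  have hbd : ∀ σ : ℝ, σ ∈ Ioo (0 : ℝ) 1 → ∃ B : ℝ, ∀ k, ‖c k * weilMellin (u k) σ‖ ≤ B := by
    intro σ hσ
    have ht : Tendsto (fun k => ‖c k * weilMellin (u k) σ‖) atTop (𝓝 ‖riemannXi σ‖) :=
      (hlim.tendsto_at (ofReal_mem_strip hσ)).norm
    obtain ⟨B, hB⟩ := ht.bddAbove_range
    exact ⟨B, fun k => hB ⟨k, rfl⟩⟩
  exact riemannHypothesis_of_tight_cruxWitness_geometric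
    ⟨a, u, c, ha, hA, hu, tight_of_nonneg hu hnn hbd, hlim⟩

/-- **The crux verbatim, with geometric windows and non-negative renormalised ground states,
implies RH.** -/
theorem riemannHypothesis_of_groundStatesConvergeToXi_nonneg_geometric
    (h : ∃ a : ℕ → ℝ, ∃ u : ℕ → ℝ → ℂ, ∃ c : ℕ → ℂ, Tendsto a atTop atTop ∧
      (∃ A : ℝ, ∀ k, a (k + 1) ≤ A * a k) ∧
      (∀ k, ∀ᵐ t : ℝ, 0 ≤ (c k * u k t).re ∧ (c k * u k t).im = 0) ∧
      (∀ k, 0 < a k ∧ c k ≠ 0 ∧ MemLp (u k) 2 ∧ ∃ g : ℕ → ℝ → ℂ,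
        (∀ n, IsWeilTest (g n) ∧ tsupport (g n) ⊆ Icc (-(a k)) (a k) ∧
          ∫ t, ‖g n t‖ ^ 2 = (1 : ℝ)) ∧
        Tendsto (fun n => (weilQuadratic (g n)).re) atTop (𝓝 (weilGroundEnergy (a k))) ∧
        Tendsto (fun n => ∫ t, ‖g n t - u k t‖ ^ 2) atTop (𝓝 0)) ∧
      TendstoLocallyUniformlyOn (fun k s => c k * weilMellin (u k) s) riemannXi atTop
        {s : ℂ | 0 < s.re ∧ s.re < 1}) :
    RiemannHypothesis := by
  obtain ⟨a, u, c, ha, hA, hnn, hk, hlim⟩ := h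
  exact riemannHypothesis_of_nonneg_cruxWitness_geometric
    ⟨a, u, c, ha, hA, fun k => ⟨(hk k).2.2.1, (hk k).2.2.2⟩, hnn, hlim⟩

/-- **Consecutive windows.**  The special case `a_k = k + 1` (every integer window carries a
ground state; ratios `(k+2)/(k+1) ≤ 2`): ground states `u_k` at the windows `k + 1` with a.e.
non-negative renormalisations `c_k u_k` whose transforms `c_k · weilMellin u_k` converge to `ξ`
locally uniformly on the open strip prove RH.  This is the form in which the limit formula is
conjectured in print (CCM25 §7: `λ → ∞` through all scales), read for positive ground states. -/
theorem riemannHypothesis_of_nonneg_cruxWitness_nat {u : ℕ → ℝ → ℂ} {c : ℕ → ℂ}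
    (hu : ∀ k : ℕ, IsWeilGroundState ((k : ℝ) + 1) (u k))
    (hnn : ∀ k, ∀ᵐ t : ℝ, 0 ≤ (c k * u k t).re ∧ (c k * u k t).im = 0)
    (hlim : TendstoLocallyUniformlyOn (fun k s => c k * weilMellin (u k) s) riemannXi atTop
      {s : ℂ | 0 < s.re ∧ s.re < 1}) :
    RiemannHypothesis :=
  riemannHypothesis_of_nonneg_cruxWitness_geometric ⟨fun k => (k : ℝ) + 1, u, c,
    tendsto_atTop_add_const_right _ 1 tendsto_natCast_atTop_atTop,
    ⟨2, fun k => by push_cast; linarith⟩, hu, hnn, hlim⟩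

end Summit.RiemannHypothesis.RiemannHypothesis.Theorems.GroundStatesConvergeToXi

end
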